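import Summits.QuantumFields.BalabanUV.Beta.GAN24.ExchangeReadout
import Summits.QuantumFields.BalabanUV.Beta.GAN24.MultiplierVertexBondSum

/-!
# `BalabanUV.Beta.GAN24.DMBondCharges` — row G-an2-4 ∕ (CONV-C), W-slot, SKELETON-W3 §7.2 zero-mode calculus, «W3-S3C*» PART 6 «THE BOND HALF»,
# module (A): ATOMS — the table-bond sum of an2's `dM` goes through the column charges; the table-summed stencil on one more constant
# field leg vanishes ((S3c)) and is block-periodic; the q-vector collapse; `dM` on two constant kernel legs has zero ff total

NOT IN PRINT; OUR BOOKKEEPING (idle-seat kernel lemma, unit `b2b-balaban-gan24-formalise-leaf-06`, gen 9; continues gen 8's PARTs 1a–5).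
HONEST FRAMING (cell contract, verbatim): «discharging `BetaPertH` makes Bałaban's UV stability UNCONDITIONAL — a real constructive-QFT result;
it is NOT the continuum limit and NOT the Clay problem.»  HONEST DEPENDENCY (verbatim): «continuum YM on T⁴ ⇐ BetaPertH ∧ nine spine estimates
(0/9 proved); BetaPertH ⇐ (D1) ∧ (D4) ∧ CAP+tail; G-an2-4 gates asym, D1 and NE2/3/4.»

WHAT ([folklore]; generic `d`, generic blocking `N ≥ 1`; a generic packed kernel `K` given by its decay, its SITE-FREE coarse-leg charges
`ρL f` ∕ `ρR g` against a multiplier leg (gen 8's hypotheses) and the vanishing of its multiplier legs off the coarse lattice; a generic local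
stencil family `S` carrying the sum rule (S3c) as `HasSum`-zero HYPOTHESES (the three conjuncts of `SpureChargeZero.hasSum_unitS_Spure`) and
block covariance; a generic block-covariant vertex family `M`; 0 `def`, 0 cite, 0 sorry):
* §0 a Fubini packaging (`hasSum_fibre_swap`), `decays_of_biLoc`, `mem_range_zsmul_iff`.
* §1 **`hasSum_vertexOfK_bond`** ∕ **`hasSum_dM_bond`**: `HasSum (u′ ↦ dM K N S M ν u′ p q c e) (Σ_κ ρR (inl κ) · Σ'_t S κ t p q c e)` — the
  TABLE-BOND sum of an2's Lagrangian-chart derivative `dM = vertexOfK + vertexOfM` goes through the column `colH K N ν u′ κ t = K t (N•u′) (inl κ) (inr ν)`,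
  i.e. through the (Q-lin) column charge; the `vertexOfM` half is leaf-14's `MultiplierVertexBondSum.hasSum_vertexOfM_bond` (= 0, (S2c)).
* §2 THE TABLE-SUMMED STENCIL `Σ'_t S κ t`: absolute summability of its `(t, leg)` families (`summable_table_leg1∕2`), ONE MORE CONSTANT FIELD
  LEG KILLS IT in either leg (`hasSum_tableSum_leg1∕2`, from the (S3c) hypotheses), and joint `N`-periodicity in its two legs (`tableSum_periodic`).
* §3 **THE q-VECTOR COLLAPSE** (`hasSum_collapse_right∕left`): `HasSum (q ↦ K p q c (inr ρ) · Ψ q) (ρR c · Ψ 0)` for an `N`-periodic `Ψ` —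
  the border's field–multiplier block on two constants emits a block-CONSTANT multiplier vector (its VALUE is never needed) which meets only the
  coarse-leg charges of `K`.
* §4 TWO CONSTANT KERNEL LEGS: `hasSum_vertexOfK_legs` (= 0 for ANY weights decaying from some centre: (S3c) legs pair), `hasSum_vertexOfM_legs`
  (value form for any weights: `Σ_ρ (Σ'_w colM …) · (Σ' M ρ 0)` by block covariance of `M`), **`hasSum_dM_legs_ff`** (= 0 for `K` itself: zero
  `colM` position mass, (S2c)).
(The HALF READ-OUTS — one outer `K`-leg summed along the coarse lattice — are the companion module `GAN24/HalfReadout`.)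
Consumed by modules (B) `SecondResponseZeroMode` and (C) `ExchangeZeroMode` (the two (S3c)-consuming channels of the W3 bracket's ff zero mode).
Asserts NO shape or value of Bałaban's tables, pins no colour constant, is NOT a W3 row, discharges NOTHING of «T2Shape»∕«T2SupRate»∕(hW, hWall).
NOT «W-slot closed», NEVER «G-an2-4 closed»; NOT BetaPertH, NOT continuum, NOT Clay.
-/

noncomputable section

open Finset
open scoped BigOperators
open Literature.MathematicalPhysics.QuantumFieldTheory
open Literature.MathematicalPhysics.QuantumFieldTheory.Balaban1983to89
open Literature.MathematicalPhysics.QuantumFieldTheory.Balaban1983to89.Beta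
open Literature.Probability.LatticeModels (Torus.proj)
open LatticeForm (quo)
open B12Sec2to5 (l1 l1_nonneg)
open ExpKernelCalculus (Site MKer BiLoc Decays VertexFamily comp shiftK Zl Zl_nonneg summable_exp_shift summable_exp_shift' tsum_exp_shift
  tsum_exp_shift' l1_sub_triangle l1_sub_symm)
open OneStepResolventKernel (Fib LocStencil wsum eq_zsmul_quo_of_proj proj_zsmul quo_zsmul)
open OneStepKernelFamily (colH abs_colH_le vertexOfK)
open SecondOrderResponse (colM vertexOfM dM dM_apply abs_colM_le)
open InterLevelTransport (cwsum_apply)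
open Summit.QuantumFields.BalabanUV.Beta.GAN24.KernelLegCharges (summable_exp_coarse hasSum_prod_wsum hasSum_prod_wsum_of_kernels
  tsum_prod_shiftK)
open Summit.QuantumFields.BalabanUV.Beta.GAN24.ResolventLegCharges (tsum_exp_coarse_le tsum_exp_coarse_le' summable_exp_coarse')
open Summit.QuantumFields.BalabanUV.Beta.GAN24.MultiplierVertexBondSum (hasSum_vertexOfM_bond zsmul_injective)

namespace Summit.QuantumFields.BalabanUV.Beta.GAN24.DMBondCharges

variable {d : ℕ}

/-! ## §0 A Fubini packaging and two small bricks -/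

/-- [folklore] **FUBINI PACKAGING**: an absolutely summable double family whose first-index fibres have the sums `g a` has, for its
second-index fibre sums, `HasSum (b ↦ Σ'_a G (a, b)) (Σ'_a g a)`. -/
theorem hasSum_fibre_swap {α β : Type*} {G : α × β → ℝ} (hG : Summable G) {g : α → ℝ}
    (hfib : ∀ a, HasSum (fun b => G (a, b)) (g a)) :
    HasSum (fun b => ∑' a, G (a, b)) (∑' a, g a) := by
  have h1 : HasSum g (∑' ab, G ab) := hG.hasSum.prod_fiberwise hfib
  have h2 : HasSum (fun b => ∑' a, G (a, b)) (∑' ba : β × α, G ba.swap) :=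
    hG.prod_symm.hasSum.prod_fiberwise fun b => (hG.prod_symm.prod_factor b).hasSum
  have e2 : ∑' ba : β × α, G ba.swap = ∑' ab, G ab := (Equiv.prodComm β α).tsum_eq G
  rw [h1.tsum_eq, ← e2]
  exact h2

/-- [folklore] A kernel bi-localised at one centre DECAYS translation-invariantly with the same constant and rate (triangle inequality). -/
theorem decays_of_biLoc {D : ℕ} {F : Type*} {K : MKer D F} {p : Site D} {C δ : ℝ} (h : BiLoc K p p C δ) (hδ : 0 ≤ δ) : Decays K C δ := by
  intro x y a b
  have hC : 0 ≤ C := h.nonneg a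
  refine (h x y a b).trans (mul_le_mul_of_nonneg_left ?_ hC)
  rw [Real.exp_le_exp]
  have ht := l1_sub_triangle x p y
  rw [l1_sub_symm p y] at ht
  nlinarith

variable {N : ℕ} [NeZero N]

/-- [folklore] A fine site lies on the coarse lattice `N•ℤ^{d+1}` iff its residue vanishes. -/
theorem mem_range_zsmul_iff (q : Site (d + 1)) : q ∈ Set.range (fun q' : Site (d + 1) => (N : ℤ) • q') ↔ Torus.proj N q = 0 := by
  refine ⟨?_, fun h => ⟨quo N q, (eq_zsmul_quo_of_proj h).symm⟩⟩
  rintro ⟨q', rfl⟩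
  exact proj_zsmul q'

/-! ## §1 The table-bond sum of `vertexOfK` and of `dM` goes through the column charges -/

/-- [folklore] **TABLE-BOND SUM OF THE CHAIN-RULE VERTEX THROUGH THE COLUMN CHARGE**: `K` decaying (rate `m > 0`) with SITE-FREE column
charges `Σ_{u′} K w (N•u′) g (inr ν) = ρR g`, `S` a local stencil family (rate `m`) ⟹ for all kernel legs `(p, q)` and fibre indices `(c, e)`,
`HasSum (u′ ↦ vertexOfK K N S ν u′ p q c e) (Σ_κ ρR (inl κ) · Σ'_t S κ t p q c e)` — the TABLE-SUMMED stencil weighted by the field charges. -/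
theorem hasSum_vertexOfK_bond {K : MKer (d + 1) (Fib d)} {C m : ℝ} (hK : Decays K C m) (hm : 0 < m) (ν : Fin (d + 1))
    {ρR : Fib d → ℝ} (hcol : ∀ g w, HasSum (fun z' : Site (d + 1) => K w ((N : ℤ) • z') g (Sum.inr ν)) (ρR g))
    {S : Fin (d + 1) → Site (d + 1) → MKer (d + 1) (Fib d)} {Cs : ℝ} (hS : LocStencil S Cs m)
    (p q : Site (d + 1)) (c e : Fib d) :
    HasSum (fun u' : Site (d + 1) => vertexOfK K N S ν u' p q c e)
      (∑ κ : Fin (d + 1), ρR (Sum.inl κ) * ∑' t : Site (d + 1), S κ t p q c e) := by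
  have hN : 1 ≤ N := Nat.one_le_iff_ne_zero.2 (NeZero.ne N)
  have hC : 0 ≤ C := hK.nonneg (Sum.inl 0)
  have hCs : 0 ≤ Cs := (hS 0 0).nonneg (Sum.inl 0)
  have hU0 : 0 ≤ Real.exp (m * ((N : ℝ) * (d + 1))) * Zl (d + 1) m := mul_nonneg (Real.exp_pos _).le (Zl_nonneg hm)
  -- one colour `κ` at a time
  have key : ∀ κ : Fin (d + 1), HasSum (fun u' : Site (d + 1) => ∑' t : Site (d + 1), colH K N ν u' κ t * S κ t p q c e)
      (ρR (Sum.inl κ) * ∑' t : Site (d + 1), S κ t p q c e) := by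
    intro κ
    -- the double family `(t, u′)` and its majorant
    have hGle : ∀ tu : Site (d + 1) × Site (d + 1), |colH K N ν tu.2 κ tu.1 * S κ tu.1 p q c e|
        ≤ (Cs * Real.exp (-m * l1 (p - tu.1))) * (C * Real.exp (-m * l1 (tu.1 - (N : ℤ) • tu.2))) := by
      intro tu
      rw [abs_mul, mul_comm]
      refine mul_le_mul ?_ (abs_colH_le (N := N) hK ν tu.2 κ tu.1) (abs_nonneg _) (mul_nonneg hCs (Real.exp_pos _).le)
      refine (hS κ tu.1 p q c e).trans (mul_le_mul_of_nonneg_left ?_ hCs)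
      rw [Real.exp_le_exp]
      nlinarith [l1_nonneg (q - tu.1), l1_nonneg (p - tu.1)]
    have hM0 : 0 ≤ fun tu : Site (d + 1) × Site (d + 1) =>
        (Cs * Real.exp (-m * l1 (p - tu.1))) * (C * Real.exp (-m * l1 (tu.1 - (N : ℤ) • tu.2))) := fun tu => by positivity
    have hMfib : ∀ t : Site (d + 1), Summable fun u' : Site (d + 1) =>
        (Cs * Real.exp (-m * l1 (p - t))) * (C * Real.exp (-m * l1 (t - (N : ℤ) • u'))) :=
      fun t => ((summable_exp_coarse' (d := d) hN hm t).mul_left C).mul_left _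
    have hb : ∀ t : Site (d + 1),
        ∑' u' : Site (d + 1), (Cs * Real.exp (-m * l1 (p - t))) * (C * Real.exp (-m * l1 (t - (N : ℤ) • u')))
          ≤ (Cs * C * (Real.exp (m * ((N : ℝ) * (d + 1))) * Zl (d + 1) m)) * Real.exp (-m * l1 (p - t)) := by
      intro t
      rw [tsum_mul_left, tsum_mul_left]
      have h1 := tsum_exp_coarse_le' (d := d) N hm t
      have h0 : 0 ≤ Cs * Real.exp (-m * l1 (p - t)) := by positivity
      have h2 := mul_le_mul_of_nonneg_left (mul_le_mul_of_nonneg_left h1 hC) h0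
      refine h2.trans (le_of_eq ?_)
      ring
    have hMsum : Summable fun t : Site (d + 1) =>
        ∑' u' : Site (d + 1), (Cs * Real.exp (-m * l1 (p - t))) * (C * Real.exp (-m * l1 (t - (N : ℤ) • u'))) :=
      Summable.of_nonneg_of_le (fun t => tsum_nonneg fun u' => hM0 (t, u')) hb ((summable_exp_shift hm p).mul_left _)
    have hmaj : Summable fun tu : Site (d + 1) × Site (d + 1) =>
        (Cs * Real.exp (-m * l1 (p - tu.1))) * (C * Real.exp (-m * l1 (tu.1 - (N : ℤ) • tu.2))) :=
      (summable_prod_of_nonneg hM0).2 ⟨hMfib, hMsum⟩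
    have hGs : Summable fun tu : Site (d + 1) × Site (d + 1) => colH K N ν tu.2 κ tu.1 * S κ tu.1 p q c e :=
      Summable.of_norm_bounded hmaj (fun tu => by rw [Real.norm_eq_abs]; exact hGle tu)
    -- `u′`-fibres at fixed `t`: the column charge
    have hfib : ∀ t : Site (d + 1), HasSum (fun u' : Site (d + 1) => colH K N ν u' κ t * S κ t p q c e)
        (ρR (Sum.inl κ) * S κ t p q c e) := fun t => (hcol (Sum.inl κ) t).mul_right (S κ t p q c e)
    have h := hasSum_fibre_swap hGs hfib
    rwa [tsum_mul_left] at h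
  have h := hasSum_sum (s := (Finset.univ : Finset (Fin (d + 1)))) fun κ _ => key κ
  refine h.congr_fun fun u' => ?_
  simp only [vertexOfK, wsum]

/-- [folklore] **TABLE-BOND SUM OF an2's `dM`**: with, in addition, ZERO bond mass of the multiplier columns ((S2c)) and a vertex family `M`,
`HasSum (u′ ↦ dM K N S M ν u′ p q c e) (Σ_κ ρR (inl κ) · Σ'_t S κ t p q c e)` (the `vertexOfM` half is leaf-14's `hasSum_vertexOfM_bond`). -/
theorem hasSum_dM_bond {K : MKer (d + 1) (Fib d)} {C m : ℝ} (hK : Decays K C m) (hm : 0 < m) (ν : Fin (d + 1))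
    {ρR : Fib d → ℝ} (hcol : ∀ g w, HasSum (fun z' : Site (d + 1) => K w ((N : ℤ) • z') g (Sum.inr ν)) (ρR g))
    (hK0 : ∀ μ ρ w, HasSum (fun y : Site (d + 1) => colM K N μ y ρ w) 0)
    {S : Fin (d + 1) → Site (d + 1) → MKer (d + 1) (Fib d)} {Cs : ℝ} (hS : LocStencil S Cs m)
    {M : Fin (d + 1) → Site (d + 1) → MKer (d + 1) (Fib d)} {CM : ℝ} (hM : VertexFamily M N CM m)
    (p q : Site (d + 1)) (c e : Fib d) :
    HasSum (fun u' : Site (d + 1) => dM K N S M ν u' p q c e)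
      (∑ κ : Fin (d + 1), ρR (Sum.inl κ) * ∑' t : Site (d + 1), S κ t p q c e) := by
  have h1 := hasSum_vertexOfK_bond hK hm ν hcol hS p q c e
  have h2 := hasSum_vertexOfM_bond (N := N) hK hm hK0 hM hm ν p q c e
  have h := h1.add h2
  rw [add_zero] at h
  exact h.congr_fun fun u' => by rw [dM_apply]

/-! ## §2 The table-summed stencil: summability, one more constant field leg, block periodicity -/

section TableSum

variable {S : Fin (d + 1) → Site (d + 1) → MKer (d + 1) (Fib d)} {Cs m : ℝ}

omit [NeZero N] in
/-- [folklore] The `(t, first leg)` family of a local stencil at a fixed second leg converges absolutely. -/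
theorem summable_table_leg1 (hS : LocStencil S Cs m) (hm : 0 < m) (κ : Fin (d + 1)) (q : Site (d + 1)) (c e : Fib d) :
    Summable fun tp : Site (d + 1) × Site (d + 1) => S κ tp.1 tp.2 q c e := by
  have hCs : 0 ≤ Cs := (hS 0 0).nonneg (Sum.inl 0)
  have hM0 : 0 ≤ fun tp : Site (d + 1) × Site (d + 1) => (Cs * Real.exp (-m * l1 (q - tp.1))) * Real.exp (-m * l1 (tp.2 - tp.1)) :=
    fun tp => by positivity
  have hMfib : ∀ t : Site (d + 1), Summable fun p : Site (d + 1) => (Cs * Real.exp (-m * l1 (q - t))) * Real.exp (-m * l1 (p - t)) :=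
    fun t => (summable_exp_shift' hm t).mul_left _
  have hMsum : Summable fun t : Site (d + 1) => ∑' p : Site (d + 1), (Cs * Real.exp (-m * l1 (q - t))) * Real.exp (-m * l1 (p - t)) := by
    have e : (fun t : Site (d + 1) => ∑' p : Site (d + 1), (Cs * Real.exp (-m * l1 (q - t))) * Real.exp (-m * l1 (p - t)))
        = fun t => (Cs * Zl (d + 1) m) * Real.exp (-m * l1 (q - t)) := by
      funext t
      rw [tsum_mul_left, tsum_exp_shift']
      ring
    rw [e]
    exact (summable_exp_shift hm q).mul_left _
  have hmaj : Summable fun tp : Site (d + 1) × Site (d + 1) =>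
      (Cs * Real.exp (-m * l1 (q - tp.1))) * Real.exp (-m * l1 (tp.2 - tp.1)) := (summable_prod_of_nonneg hM0).2 ⟨hMfib, hMsum⟩
  refine Summable.of_norm_bounded hmaj (fun tp => ?_)
  rw [Real.norm_eq_abs]
  have h := hS κ tp.1 tp.2 q c e
  rw [mul_add, Real.exp_add] at h
  calc |S κ tp.1 tp.2 q c e| ≤ Cs * (Real.exp (-m * l1 (tp.2 - tp.1)) * Real.exp (-m * l1 (q - tp.1))) := h
    _ = _ := by ring

omit [NeZero N] in
/-- [folklore] The `(t, second leg)` family of a local stencil at a fixed first leg converges absolutely. -/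
theorem summable_table_leg2 (hS : LocStencil S Cs m) (hm : 0 < m) (κ : Fin (d + 1)) (p : Site (d + 1)) (c e : Fib d) :
    Summable fun tq : Site (d + 1) × Site (d + 1) => S κ tq.1 p tq.2 c e := by
  have hCs : 0 ≤ Cs := (hS 0 0).nonneg (Sum.inl 0)
  have hM0 : 0 ≤ fun tq : Site (d + 1) × Site (d + 1) => (Cs * Real.exp (-m * l1 (p - tq.1))) * Real.exp (-m * l1 (tq.2 - tq.1)) :=
    fun tq => by positivity
  have hMfib : ∀ t : Site (d + 1), Summable fun q : Site (d + 1) => (Cs * Real.exp (-m * l1 (p - t))) * Real.exp (-m * l1 (q - t)) :=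
    fun t => (summable_exp_shift' hm t).mul_left _
  have hMsum : Summable fun t : Site (d + 1) => ∑' q : Site (d + 1), (Cs * Real.exp (-m * l1 (p - t))) * Real.exp (-m * l1 (q - t)) := by
    have e : (fun t : Site (d + 1) => ∑' q : Site (d + 1), (Cs * Real.exp (-m * l1 (p - t))) * Real.exp (-m * l1 (q - t)))
        = fun t => (Cs * Zl (d + 1) m) * Real.exp (-m * l1 (p - t)) := by
      funext t
      rw [tsum_mul_left, tsum_exp_shift']
      ring
    rw [e]
    exact (summable_exp_shift hm p).mul_left _
  have hmaj : Summable fun tq : Site (d + 1) × Site (d + 1) =>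
      (Cs * Real.exp (-m * l1 (p - tq.1))) * Real.exp (-m * l1 (tq.2 - tq.1)) := (summable_prod_of_nonneg hM0).2 ⟨hMfib, hMsum⟩
  refine Summable.of_norm_bounded hmaj (fun tq => ?_)
  rw [Real.norm_eq_abs]
  have h := hS κ tq.1 p tq.2 c e
  rw [mul_add, Real.exp_add] at h
  calc |S κ tq.1 p tq.2 c e| ≤ Cs * (Real.exp (-m * l1 (p - tq.1)) * Real.exp (-m * l1 (tq.2 - tq.1))) := h
    _ = _ := by ring

omit [NeZero N] in
/-- [folklore] Hence the table-summed stencil has summable first-leg slices … -/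
theorem summable_tableSum_leg1 (hS : LocStencil S Cs m) (hm : 0 < m) (κ : Fin (d + 1)) (q : Site (d + 1)) (c e : Fib d) :
    Summable fun p : Site (d + 1) => ∑' t : Site (d + 1), S κ t p q c e :=
  (summable_table_leg1 hS hm κ q c e).prod_symm.prod

omit [NeZero N] in
/-- [folklore] … and summable second-leg slices. -/
theorem summable_tableSum_leg2 (hS : LocStencil S Cs m) (hm : 0 < m) (κ : Fin (d + 1)) (p : Site (d + 1)) (c e : Fib d) :
    Summable fun q : Site (d + 1) => ∑' t : Site (d + 1), S κ t p q c e :=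
  (summable_table_leg2 hS hm κ p c e).prod_symm.prod

omit [NeZero N] in
/-- [folklore] **(S3c), TABLE + FIRST LEG ⇒ the table-summed stencil on a constant FIRST field leg vanishes**: from
`HasSum ((t, p) ↦ S κ t p q (inl a) (inl b)) 0` (second leg `q` fixed), `HasSum (p ↦ Σ'_t S κ t p q (inl a) (inl b)) 0`. -/
theorem hasSum_tableSum_leg1 {κ : Fin (d + 1)} {q : Site (d + 1)} {a b : Fin (d + 1)}
    (h0 : HasSum (fun tp : Site (d + 1) × Site (d + 1) => S κ tp.1 tp.2 q (Sum.inl a) (Sum.inl b)) 0) :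
    HasSum (fun p : Site (d + 1) => ∑' t : Site (d + 1), S κ t p q (Sum.inl a) (Sum.inl b)) 0 := by
  have h := hasSum_fibre_swap h0.summable (fun t => (h0.summable.prod_factor t).hasSum)
  rwa [← h0.summable.tsum_prod, h0.tsum_eq] at h

omit [NeZero N] in
/-- [folklore] **(S3c), TABLE + SECOND LEG ⇒ the table-summed stencil on a constant SECOND field leg vanishes**: from
`HasSum ((t, q) ↦ S κ t p q (inl a) (inl b)) 0` (first leg `p` fixed), `HasSum (q ↦ Σ'_t S κ t p q (inl a) (inl b)) 0`. -/
theorem hasSum_tableSum_leg2 {κ : Fin (d + 1)} {p : Site (d + 1)} {a b : Fin (d + 1)}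
    (h0 : HasSum (fun tq : Site (d + 1) × Site (d + 1) => S κ tq.1 p tq.2 (Sum.inl a) (Sum.inl b)) 0) :
    HasSum (fun q : Site (d + 1) => ∑' t : Site (d + 1), S κ t p q (Sum.inl a) (Sum.inl b)) 0 := by
  have h := hasSum_fibre_swap h0.summable (fun t => (h0.summable.prod_factor t).hasSum)
  rwa [← h0.summable.tsum_prod, h0.tsum_eq] at h

omit [NeZero N] in
/-- [folklore] **JOINT BLOCK PERIODICITY OF THE TABLE-SUMMED STENCIL** for a block-covariant family:
`Σ'_t S κ t (p + N•s) (q + N•s) c e = Σ'_t S κ t p q c e` (re-index `t ↦ t + N•s`; no summability needed). -/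
theorem tableSum_periodic (hSt : ∀ (κ : Fin (d + 1)) (u s : Site (d + 1)), S κ (u + (N : ℤ) • s) = shiftK (-((N : ℤ) • s)) (S κ u))
    (κ : Fin (d + 1)) (p q : Site (d + 1)) (c e : Fib d) (s : Site (d + 1)) :
    (∑' t : Site (d + 1), S κ t (p + (N : ℤ) • s) (q + (N : ℤ) • s) c e) = ∑' t : Site (d + 1), S κ t p q c e := by
  rw [← (Equiv.addRight ((N : ℤ) • s)).tsum_eq (fun t => S κ t (p + (N : ℤ) • s) (q + (N : ℤ) • s) c e)]
  refine tsum_congr fun t => ?_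
  simp only [Equiv.coe_addRight]
  rw [hSt κ t s]
  simp only [shiftK, add_neg_cancel_right]

end TableSum

/-! ## §3 The q-vector collapse: a block-periodic scalar against a multiplier leg of `K` -/

/-- [folklore] **THE q-VECTOR COLLAPSE (second leg).**  If the multiplier SECOND legs of `K` vanish off the coarse lattice and have the
site-free column charges `ρR g` against `inr β`, then for every `N`-periodic scalar `Ψ` and every first leg `(p, c)`:
`HasSum (q ↦ K p q c (inr β) · Ψ q) (ρR c · Ψ 0)` — only the value of `Ψ` on the coarse lattice (a constant) is seen. -/
theorem hasSum_collapse_right {K : MKer (d + 1) (Fib d)} (β : Fin (d + 1)) {ρR : Fib d → ℝ}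
    (hcol : ∀ g w, HasSum (fun z' : Site (d + 1) => K w ((N : ℤ) • z') g (Sum.inr β)) (ρR g))
    (hoffR : ∀ (x z : Site (d + 1)) (a : Fib d), Torus.proj N z ≠ 0 → K x z a (Sum.inr β) = 0)
    {Ψ : Site (d + 1) → ℝ} (hΨ : ∀ q s : Site (d + 1), Ψ (q + (N : ℤ) • s) = Ψ q) (p : Site (d + 1)) (c : Fib d) :
    HasSum (fun q : Site (d + 1) => K p q c (Sum.inr β) * Ψ q) (ρR c * Ψ 0) := by
  have hinj : Function.Injective (fun q' : Site (d + 1) => (N : ℤ) • q') := zsmul_injective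
  have hzero : ∀ q ∉ Set.range (fun q' : Site (d + 1) => (N : ℤ) • q'), K p q c (Sum.inr β) * Ψ q = 0 := by
    intro q hq
    rw [mem_range_zsmul_iff] at hq
    rw [hoffR p q c hq, zero_mul]
  refine (hinj.hasSum_iff hzero).1 ?_
  have e : ∀ q' : Site (d + 1), Ψ ((N : ℤ) • q') = Ψ 0 := fun q' => by
    have h := hΨ 0 q'
    rwa [zero_add] at h
  show HasSum (fun q' : Site (d + 1) => K p ((N : ℤ) • q') c (Sum.inr β) * Ψ ((N : ℤ) • q')) _
  simp_rw [e]
  exact (hcol c p).mul_right (Ψ 0)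

/-- [folklore] **THE q-VECTOR COLLAPSE (first leg)**: the mirror statement for the multiplier FIRST legs of `K` (vanishing off the coarse
lattice, site-free row charges `ρL f` against `inr α`): `HasSum (p ↦ Ψ p · K p q (inr α) e) (Ψ 0 · ρL e)`. -/
theorem hasSum_collapse_left {K : MKer (d + 1) (Fib d)} (α : Fin (d + 1)) {ρL : Fib d → ℝ}
    (hrow : ∀ f y, HasSum (fun x' : Site (d + 1) => K ((N : ℤ) • x') y (Sum.inr α) f) (ρL f))
    (hoffL : ∀ (x z : Site (d + 1)) (b : Fib d), Torus.proj N x ≠ 0 → K x z (Sum.inr α) b = 0)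
    {Ψ : Site (d + 1) → ℝ} (hΨ : ∀ p s : Site (d + 1), Ψ (p + (N : ℤ) • s) = Ψ p) (q : Site (d + 1)) (e : Fib d) :
    HasSum (fun p : Site (d + 1) => Ψ p * K p q (Sum.inr α) e) (Ψ 0 * ρL e) := by
  have hinj : Function.Injective (fun p' : Site (d + 1) => (N : ℤ) • p') := zsmul_injective
  have hzero : ∀ p ∉ Set.range (fun p' : Site (d + 1) => (N : ℤ) • p'), Ψ p * K p q (Sum.inr α) e = 0 := by
    intro p hp
    rw [mem_range_zsmul_iff] at hp
    rw [hoffL p q e hp, mul_zero]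
  refine (hinj.hasSum_iff hzero).1 ?_
  have e1 : ∀ p' : Site (d + 1), Ψ ((N : ℤ) • p') = Ψ 0 := fun p' => by
    have h := hΨ 0 p'
    rwa [zero_add] at h
  show HasSum (fun p' : Site (d + 1) => Ψ ((N : ℤ) • p') * K ((N : ℤ) • p') q (Sum.inr α) e) _
  simp_rw [e1]
  exact (hrow e q).mul_left (Ψ 0)

/-! ## §4 `vertexOfK`, `vertexOfM`, `dM` on two constant kernel legs -/

section Legs

variable {S : Fin (d + 1) → Site (d + 1) → MKer (d + 1) (Fib d)} {Cs m : ℝ}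
  {M : Fin (d + 1) → Site (d + 1) → MKer (d + 1) (Fib d)} {CM : ℝ}

omit [NeZero N] in
/-- [folklore] **THE CHAIN-RULE VERTEX ON TWO CONSTANT KERNEL LEGS VANISHES** — through ANY kernel `K′` whose `ℋ`-column weights decay from
some centre — as soon as every stencil `S κ t` has zero field–field double-leg sum ((S3c), legs pair):
`HasSum ((v, p) ↦ vertexOfK K′ N S μ y v p (inl a) (inl b)) 0`. -/
theorem hasSum_vertexOfK_legs {K' : MKer (d + 1) (Fib d)} {C' : ℝ} {c₀ : Site (d + 1)} (hm : 0 < m) (μ : Fin (d + 1)) (y : Site (d + 1))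
    (hw : ∀ (κ : Fin (d + 1)) (t : Site (d + 1)), |colH K' N μ y κ t| ≤ C' * Real.exp (-m * l1 (t - c₀)))
    (hS : LocStencil S Cs m)
    (hS0 : ∀ (κ : Fin (d + 1)) (t : Site (d + 1)) (a b : Fin (d + 1)),
      HasSum (fun vp : Site (d + 1) × Site (d + 1) => S κ t vp.1 vp.2 (Sum.inl a) (Sum.inl b)) 0)
    (a b : Fin (d + 1)) :
    HasSum (fun vp : Site (d + 1) × Site (d + 1) => vertexOfK K' N S μ y vp.1 vp.2 (Sum.inl a) (Sum.inl b)) 0 := by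
  have h1 : ∀ t : Site (d + 1), ((1 : ℕ) : ℤ) • t = t := fun t => by simp
  have key : ∀ κ : Fin (d + 1), HasSum (fun vp : Site (d + 1) × Site (d + 1) =>
      ∑' t : Site (d + 1), colH K' N μ y κ t * S κ t vp.1 vp.2 (Sum.inl a) (Sum.inl b)) 0 := by
    intro κ
    have hw' : ∀ t : Site (d + 1), |colH K' N μ y κ t| ≤ C' * Real.exp (-m * l1 (((1 : ℕ) : ℤ) • t - c₀)) := fun t => by
      rw [h1]; exact hw κ t
    have hQ : ∀ t : Site (d + 1), BiLoc (S κ t) (((1 : ℕ) : ℤ) • t) (((1 : ℕ) : ℤ) • t) Cs m := fun t => by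
      rw [h1]; exact hS κ t
    exact hasSum_prod_wsum_of_kernels (N := 1) le_rfl hw' hm hQ hm (Sum.inl a) (Sum.inl b) (fun t => (hS0 κ t a b).tsum_eq)
  have h := hasSum_sum (s := (Finset.univ : Finset (Fin (d + 1)))) fun κ _ => key κ
  rw [Finset.sum_const_zero] at h
  refine h.congr_fun fun vp => ?_
  simp only [vertexOfK, wsum]

/-- [folklore] **THE MULTIPLIER VERTEX ON TWO CONSTANT KERNEL LEGS, VALUE FORM** — through ANY kernel `K′` whose multiplier-column weights decay
(at the coarse scale) from some centre, for a block-covariant vertex family `M` (`M ρ (w + t) = shiftK (−N•t) (M ρ w)`): the double-leg family has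
`HasSum` `Σ_ρ (Σ'_w colM K′ N μ y ρ w) · (Σ'_{(v,p)} M ρ 0 v p a b)` — every member `M ρ w` has the SAME double-leg sum. -/
theorem hasSum_vertexOfM_legs {K' : MKer (d + 1) (Fib d)} {C' : ℝ} {c₀ : Site (d + 1)} (hm : 0 < m) (μ : Fin (d + 1)) (y : Site (d + 1))
    (hw : ∀ (ρ : Fin (d + 1)) (w : Site (d + 1)), |colM K' N μ y ρ w| ≤ C' * Real.exp (-m * l1 ((N : ℤ) • w - c₀)))
    (hM : VertexFamily M N CM m)
    (hMt : ∀ (ρ : Fin (d + 1)) (w t : Site (d + 1)), M ρ (w + t) = shiftK (-((N : ℤ) • t)) (M ρ w)) (a b : Fib d) :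
    HasSum (fun vp : Site (d + 1) × Site (d + 1) => vertexOfM K' N M μ y vp.1 vp.2 a b)
      (∑ ρ : Fin (d + 1), (∑' w : Site (d + 1), colM K' N μ y ρ w) * ∑' vp : Site (d + 1) × Site (d + 1), M ρ 0 vp.1 vp.2 a b) := by
  have hN : 1 ≤ N := Nat.one_le_iff_ne_zero.2 (NeZero.ne N)
  have key : ∀ ρ : Fin (d + 1), HasSum (fun vp : Site (d + 1) × Site (d + 1) =>
      ∑' w : Site (d + 1), colM K' N μ y ρ w * M ρ w vp.1 vp.2 a b)
      ((∑' w : Site (d + 1), colM K' N μ y ρ w) * ∑' vp : Site (d + 1) × Site (d + 1), M ρ 0 vp.1 vp.2 a b) := by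
    intro ρ
    have h := hasSum_prod_wsum hN (hw ρ) hm (hM ρ) hm a b
    have hT : ∀ w : Site (d + 1), ∑' vp : Site (d + 1) × Site (d + 1), M ρ w vp.1 vp.2 a b
        = ∑' vp : Site (d + 1) × Site (d + 1), M ρ 0 vp.1 vp.2 a b := by
      intro w
      have e : M ρ w = shiftK (-((N : ℤ) • w)) (M ρ 0) := by
        have h0 := hMt ρ 0 w
        rwa [zero_add] at h0
      rw [e, tsum_prod_shiftK]
    simp_rw [hT] at h
    rwa [tsum_mul_right] at h
  have h := hasSum_sum (s := (Finset.univ : Finset (Fin (d + 1)))) fun ρ _ => key ρ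
  refine h.congr_fun fun vp => ?_
  simp only [vertexOfM, cwsum_apply]

/-- [folklore] **an2's `dM` ON TWO CONSTANT KERNEL LEGS HAS ZERO ff TOTAL**: for a decaying `K` whose multiplier columns have zero POSITION
mass ((S2c): `Σ_w K (N•w) (N•y) (inr ρ) (inr μ) = 0`), a local stencil family with the (S3c) legs-pair sum rule and a block-covariant vertex
family `M`: `HasSum ((v, p) ↦ dM K N S M μ y v p (inl a) (inl b)) 0` for every bond `(μ, y)`. -/
theorem hasSum_dM_legs_ff {K : MKer (d + 1) (Fib d)} {C : ℝ} (hK : Decays K C m) (hm : 0 < m)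
    (hK0' : ∀ (μ ρ : Fin (d + 1)) (y : Site (d + 1)), HasSum (fun w : Site (d + 1) => colM K N μ y ρ w) 0)
    (hS : LocStencil S Cs m)
    (hS0 : ∀ (κ : Fin (d + 1)) (t : Site (d + 1)) (a b : Fin (d + 1)),
      HasSum (fun vp : Site (d + 1) × Site (d + 1) => S κ t vp.1 vp.2 (Sum.inl a) (Sum.inl b)) 0)
    (hM : VertexFamily M N CM m)
    (hMt : ∀ (ρ : Fin (d + 1)) (w t : Site (d + 1)), M ρ (w + t) = shiftK (-((N : ℤ) • t)) (M ρ w))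
    (μ : Fin (d + 1)) (y : Site (d + 1)) (a b : Fin (d + 1)) :
    HasSum (fun vp : Site (d + 1) × Site (d + 1) => dM K N S M μ y vp.1 vp.2 (Sum.inl a) (Sum.inl b)) 0 := by
  have h1 := hasSum_vertexOfK_legs (c₀ := (N : ℤ) • y) hm μ y (fun κ t => abs_colH_le (N := N) hK μ y κ t) hS hS0 a b
  have h2 := hasSum_vertexOfM_legs (c₀ := (N : ℤ) • y) hm μ y (fun ρ w => abs_colM_le (N := N) hK μ y ρ w) hM hMt
    (Sum.inl a) (Sum.inl b)
  have h0 : ∀ ρ : Fin (d + 1), ∑' w : Site (d + 1), colM K N μ y ρ w = 0 := fun ρ => (hK0' μ ρ y).tsum_eq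
  simp_rw [h0, zero_mul, Finset.sum_const_zero] at h2
  have h := h1.add h2
  rw [add_zero] at h
  exact h.congr_fun fun vp => by rw [dM_apply]

end Legs

end Summit.QuantumFields.BalabanUV.Beta.GAN24.DMBondCharges

end
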